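import Literature.Analysis.ODE.ComplexSecondOrder
import Mathlib.Analysis.Calculus.DerivativeTest
import Mathlib.Analysis.SpecialFunctions.Trigonometric.Deriv
import HarnessLib

/-!
# Zeros of real solutions of `y'' = Q(t) y`: simplicity, persistence, non-oscillation where
# `Q > 0`, convexity, and Sturm's comparison with `sin`

Topic `Literature/Analysis/ODE` (namespace `Literature.Analysis.ODE`), the real case `𝕜 = ℝ` of
`ComplexSecondOrder.lean` (solutions `IsSol2 Q y y' (Ioi r₀)` on a half-line). The classical
qualitative facts used by shooting arguments in a spectral parameter (Hartman, *Ordinary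
Differential Equations*, Ch. XI §§3, 6), all proved:

* `IsSol2.deriv_ne_zero_of_zero` — zeros of a solution which is not identically zero are simple;
  `IsSol2.exists_pos_neg_near_zero` — hence the solution takes both signs near a zero, and
  `exists_zero_of_close` — a function uniformly close to it on a neighbourhood has a zero there
  (**zeros persist under perturbation**);
* `IsSol2.eqOn_zero_of_two_zeros` — on an interval where `Q > 0` a non-trivial solution has
  **at most one zero** (a positive interior maximum would have `y'' = Q y > 0`);
* `IsSol2.pos_of_nonneg` — **convexity propagation**: `Q ≥ 0` on `[t₀, ∞)`, `y t₀ > 0`,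
  `y' t₀ ≥ 0` give `y > 0`, `y' ≥ 0` (indeed `y ≥ y t₀`, `y' ≥ y' t₀`) on `[t₀, ∞)`;
* `IsSol2.exists_zero_of_le_neg_sq` — **Sturm comparison with `sin(k(t − A))`**: if
  `Q ≤ −k²` on `[A, A + π/k]` (`k > 0`) then every solution vanishes somewhere on that interval
  (Wronskian form of Sturm's theorem: `W = y z' − y' z` is monotone while `y, z > 0`).
* `IsSol2.ofReal_comp` — a real solution is a complex solution (bridge to the complex theory).

## References
* P. Hartman, *Ordinary Differential Equations*, Classics in Applied Mathematics 38 (SIAM 2002),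
  Ch. XI §3 (Sturm's comparison theorems, Thm. 3.1 and Cor. 3.1), §6 (disconjugacy, Cor. 6.1),
  Ch. IV Cor. 1.1. Key `Hartman2002`.
-/

noncomputable section

open Set Metric Filter Real
open scoped Topology

namespace Literature.Analysis.ODE

namespace IsSol2

variable {Q : ℝ → ℝ} {y y' : ℝ → ℝ} {r₀ : ℝ}

/-! ## Real solutions as complex solutions -/

/-- A real solution is a complex solution (of the equation with the same, real, coefficient).
[folklore] -/
theorem ofReal_comp {s : Set ℝ} (h : IsSol2 Q y y' s) :
    IsSol2 (fun t ↦ (Q t : ℂ)) (fun t ↦ (y t : ℂ)) (fun t ↦ (y' t : ℂ)) s :=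
  ⟨fun t ht ↦ (h.hasDerivAt t ht).ofReal_comp, fun t ht ↦ by
    simpa using (h.hasDerivAt_deriv t ht).ofReal_comp⟩

/-! ## Simple zeros and sign changes -/

/-- `deriv y = y'` near an interior point, hence `deriv (deriv y) t = Q t · y t`. [folklore] -/
theorem deriv_deriv_eq (h : IsSol2 Q y y' (Ioi r₀)) {t : ℝ} (ht : r₀ < t) :
    deriv y t = y' t ∧ deriv (deriv y) t = Q t * y t := by
  have hev : deriv y =ᶠ[𝓝 t] y' := by
    filter_upwards [isOpen_Ioi.mem_nhds ht] with s hs using h.deriv_eq hs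
  exact ⟨h.deriv_eq ht, by rw [hev.deriv_eq, (h.hasDerivAt_deriv t ht).deriv]⟩

/-- **Zeros of a non-trivial solution are simple**: if `y t = 0` and `y' t = 0` at some `t > r₀`
then `y ≡ 0` on `(r₀, ∞)`; contrapositively `y t = 0`, `y ≢ 0` force `y' t ≠ 0`.
[cite: Hartman2002, Ch. IV Cor. 1.1] -/
theorem deriv_ne_zero_of_zero (hQ : ContinuousOn Q (Ioi r₀)) (h : IsSol2 Q y y' (Ioi r₀)) {t : ℝ}
    (ht : r₀ < t) (h0 : y t = 0) (hne : ∃ s, r₀ < s ∧ y s ≠ 0) : y' t ≠ 0 := by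
  intro h1
  obtain ⟨s, hs, hys⟩ := hne
  exact hys ((h.eqOn_zero hQ ht h0 h1).1 hs)

/-- Near a zero of a non-trivial solution there are points where it is negative and points where
it is positive (as close to the zero as desired). [folklore] -/
theorem exists_pos_neg_near_zero (hQ : ContinuousOn Q (Ioi r₀)) (h : IsSol2 Q y y' (Ioi r₀))
    {t : ℝ} (ht : r₀ < t) (h0 : y t = 0) (hne : ∃ s, r₀ < s ∧ y s ≠ 0) {ε : ℝ} (hε : 0 < ε) :
    ∃ t₁ t₂, |t₁ - t| < ε ∧ |t₂ - t| < ε ∧ y t₁ < 0 ∧ 0 < y t₂ := by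
  have hd : deriv y t = y' t := h.deriv_eq ht
  have hy' := h.deriv_ne_zero_of_zero hQ ht h0 hne
  have hball : ∀ᶠ x in 𝓝 t, |x - t| < ε := by
    filter_upwards [Metric.ball_mem_nhds t hε] with x hx
    rwa [Metric.mem_ball, Real.dist_eq] at hx
  rcases hy'.lt_or_gt with hneg | hpos
  · -- `y > 0` to the left, `y < 0` to the right
    have hk := eventually_nhdsWithin_sign_eq_of_deriv_neg (f := y) (by rwa [hd]) h0
    have hL : ∀ᶠ x in 𝓝[<] t, (SignType.sign (y x) = SignType.sign (t - x) ∧ |x - t| < ε) ∧ x < t :=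
      ((hk.and hball).filter_mono nhdsWithin_le_nhds).and self_mem_nhdsWithin
    have hR : ∀ᶠ x in 𝓝[>] t, (SignType.sign (y x) = SignType.sign (t - x) ∧ |x - t| < ε) ∧ t < x :=
      ((hk.and hball).filter_mono nhdsWithin_le_nhds).and self_mem_nhdsWithin
    obtain ⟨x₁, ⟨hx1, hx1'⟩, hx1t⟩ := hL.exists
    obtain ⟨x₂, ⟨hx2, hx2'⟩, hx2t⟩ := hR.exists
    refine ⟨x₂, x₁, hx2', hx1', ?_, ?_⟩
    · rw [sign_neg (sub_neg.2 hx2t), sign_eq_neg_one_iff] at hx2; exact hx2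
    · rw [sign_pos (sub_pos.2 hx1t), sign_eq_one_iff] at hx1; exact hx1
  · -- `y < 0` to the left, `y > 0` to the right
    have hk := eventually_nhdsWithin_sign_eq_of_deriv_pos (f := y) (by rwa [hd]) h0
    have hL : ∀ᶠ x in 𝓝[<] t, (SignType.sign (y x) = SignType.sign (x - t) ∧ |x - t| < ε) ∧ x < t :=
      ((hk.and hball).filter_mono nhdsWithin_le_nhds).and self_mem_nhdsWithin
    have hR : ∀ᶠ x in 𝓝[>] t, (SignType.sign (y x) = SignType.sign (x - t) ∧ |x - t| < ε) ∧ t < x :=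
      ((hk.and hball).filter_mono nhdsWithin_le_nhds).and self_mem_nhdsWithin
    obtain ⟨x₁, ⟨hx1, hx1'⟩, hx1t⟩ := hL.exists
    obtain ⟨x₂, ⟨hx2, hx2'⟩, hx2t⟩ := hR.exists
    refine ⟨x₁, x₂, hx1', hx2', ?_, ?_⟩
    · rw [sign_neg (sub_neg.2 hx1t), sign_eq_neg_one_iff] at hx1; exact hx1
    · rw [sign_pos (sub_pos.2 hx2t), sign_eq_one_iff] at hx2; exact hx2

end IsSol2

/-- **Zeros persist under perturbation** (intermediate value theorem): if `y t₁ < 0 < y t₂` and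
`z` is continuous on the closed interval between `t₁` and `t₂` with `|z t₁ − y t₁| < −y t₁`,
`|z t₂ − y t₂| < y t₂` (which forces `y t₁ < 0 < y t₂`), then `z` vanishes somewhere between `t₁` and
`t₂`. [folklore] -/
theorem exists_zero_of_close {y z : ℝ → ℝ} {t₁ t₂ : ℝ}
    (hz : ContinuousOn z (uIcc t₁ t₂)) (hz1 : |z t₁ - y t₁| < -y t₁) (hz2 : |z t₂ - y t₂| < y t₂) :
    ∃ t ∈ uIcc t₁ t₂, z t = 0 := by
  have hzt1 : z t₁ < 0 := by have := (abs_lt.1 hz1).2; linarith [abs_nonneg (z t₁ - y t₁)]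
  have hzt2 : 0 < z t₂ := by have := (abs_lt.1 hz2).1; linarith [abs_nonneg (z t₂ - y t₂)]
  rcases le_or_gt t₁ t₂ with h | h
  · rw [uIcc_of_le h] at hz ⊢
    obtain ⟨t, ht, hzt⟩ := intermediate_value_Icc h hz ⟨hzt1.le, hzt2.le⟩
    exact ⟨t, ht, hzt⟩
  · rw [uIcc_of_ge h.le] at hz ⊢
    obtain ⟨t, ht, hzt⟩ := intermediate_value_Icc' h.le hz ⟨hzt1.le, hzt2.le⟩
    exact ⟨t, ht, hzt⟩

namespace IsSol2

variable {Q : ℝ → ℝ} {y y' : ℝ → ℝ} {r₀ : ℝ}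

/-! ## Non-oscillation where `Q > 0` -/

/-- **At most one zero where `Q > 0`.** If a solution on `(r₀, ∞)` vanishes at `t₁ < t₂`
(`t₁ > r₀`) and `Q > 0` on `[t₁, t₂]`, it vanishes identically: otherwise `±y` would have a positive
interior maximum `c`, where `y' c = 0` and `y'' c = Q c · y c > 0` — but then `c` is also a local
minimum (second-derivative test), `y` is locally constant at `c`, and `y'' c = 0`.
[cite: Hartman2002, Ch. XI §6 Cor. 6.1] -/
theorem eqOn_zero_of_two_zeros (hQc : ContinuousOn Q (Ioi r₀)) (h : IsSol2 Q y y' (Ioi r₀))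
    {t₁ t₂ : ℝ} (ht₁ : r₀ < t₁) (h12 : t₁ < t₂) (hQ : ∀ t ∈ Icc t₁ t₂, 0 < Q t) (hz1 : y t₁ = 0)
    (hz2 : y t₂ = 0) : EqOn y 0 (Ioi r₀) := by
  -- it suffices to treat a solution with a positive value inside
  suffices key : ∀ (w w' : ℝ → ℝ), IsSol2 Q w w' (Ioi r₀) → w t₁ = 0 → w t₂ = 0 →
      (∃ c ∈ Ioo t₁ t₂, 0 < w c) → False by
    by_contra hne
    rw [Set.EqOn, not_forall] at hne
    obtain ⟨s, hs⟩ := hne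
    rw [Classical.not_imp] at hs
    obtain ⟨hs, hys⟩ := hs
    -- `y` is not identically zero, hence has a non-zero value inside `(t₁, t₂)`
    have hin : ∃ c ∈ Ioo t₁ t₂, y c ≠ 0 := by
      by_contra hall
      push Not at hall
      set c : ℝ := (t₁ + t₂) / 2 with hc
      have hcin : c ∈ Ioo t₁ t₂ := ⟨by rw [hc]; linarith, by rw [hc]; linarith⟩
      have hcr : r₀ < c := ht₁.trans hcin.1
      have hev : y =ᶠ[𝓝 c] fun _ ↦ 0 := by
        filter_upwards [Ioo_mem_nhds hcin.1 hcin.2] with x hx using hall x hx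
      have hy'c : y' c = 0 := by rw [← h.deriv_eq hcr, hev.deriv_eq, deriv_const]
      exact hys ((h.eqOn_zero hQc hcr (hall c hcin) hy'c).1 hs)
    obtain ⟨c, hc, hyc⟩ := hin
    rcases hyc.lt_or_gt with hneg | hpos
    · exact key (fun t ↦ -y t) (fun t ↦ -y' t) h.neg (by simp [hz1]) (by simp [hz2]) ⟨c, hc, by linarith⟩
    · exact key y y' h hz1 hz2 ⟨c, hc, hpos⟩
  intro w w' hw hw1 hw2 ⟨c₀, hc₀, hwc₀⟩
  have ht₂ : r₀ < t₂ := ht₁.trans h12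
  have hsub : Icc t₁ t₂ ⊆ Ioi r₀ := fun t ht ↦ ht₁.trans_le ht.1
  have hwc : ContinuousOn w (Icc t₁ t₂) := hw.continuousOn.1.mono hsub
  -- a maximum point `c` on `[t₁, t₂]`; it is interior and positive
  obtain ⟨c, hc, hmax⟩ := isCompact_Icc.exists_isMaxOn (nonempty_Icc.2 h12.le) hwc
  have hwc_pos : 0 < w c := hwc₀.trans_le (hmax (Ioo_subset_Icc_self hc₀))
  have hc1 : c ≠ t₁ := fun h ↦ by rw [h, hw1] at hwc_pos; exact lt_irrefl _ hwc_pos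
  have hc2 : c ≠ t₂ := fun h ↦ by rw [h, hw2] at hwc_pos; exact lt_irrefl _ hwc_pos
  have hcin : c ∈ Ioo t₁ t₂ := ⟨lt_of_le_of_ne hc.1 (Ne.symm hc1), lt_of_le_of_ne hc.2 hc2⟩
  have hcr : r₀ < c := ht₁.trans hcin.1
  have hlocmax : IsLocalMax w c := hmax.isLocalMax (Icc_mem_nhds hcin.1 hcin.2)
  obtain ⟨hd1, hd2⟩ := hw.deriv_deriv_eq hcr
  have hderiv0 : deriv w c = 0 := hlocmax.deriv_eq_zero
  have hpos2 : 0 < deriv (deriv w) c := by rw [hd2]; exact mul_pos (hQ c hc) hwc_pos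
  have hlocmin : IsLocalMin w c :=
    isLocalMin_of_deriv_deriv_pos hpos2 hderiv0 (hw.hasDerivAt c hcr).continuousAt
  -- so `w` is locally constant at `c`, contradicting `w'' c > 0`
  have hconst : ∀ᶠ x in 𝓝 c, w x = w c := by
    filter_upwards [hlocmax, hlocmin] with x h1 h2 using le_antisymm h1 h2
  have hd0 : deriv w =ᶠ[𝓝 c] fun _ ↦ 0 := by
    have : ∀ᶠ x in 𝓝 c, ∀ᶠ z in 𝓝 x, w z = w c := eventually_eventually_nhds.2 hconst
    filter_upwards [this] with x hx
    rw [Filter.EventuallyEq.deriv_eq hx, deriv_const]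
  have : deriv (deriv w) c = 0 := by rw [hd0.deriv_eq, deriv_const]
  linarith

/-! ## Convexity propagation -/

/-- **Positivity propagates where `Q ≥ 0`.** If `Q ≥ 0` on `[t₀, ∞)` (`t₀ > r₀`), `y t₀ > 0` and
`y' t₀ ≥ 0`, then `y > 0` on `[t₀, ∞)` (the first zero `c` would have `y'` nondecreasing, hence
`y` nondecreasing, on `[t₀, c]`; "the graph is concave upwards when `y > 0`", Hartman Ch. XI, proof of
Cor. 6.4). [cite: Hartman2002, Ch. XI Cor. 6.4] -/
theorem pos_of_nonneg (h : IsSol2 Q y y' (Ioi r₀)) {t₀ : ℝ} (ht₀ : r₀ < t₀)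
    (hQ : ∀ t, t₀ ≤ t → 0 ≤ Q t) (hy0 : 0 < y t₀) (hy1 : 0 ≤ y' t₀) : ∀ t, t₀ ≤ t → 0 < y t := by
  have hcr : ∀ s, t₀ ≤ s → r₀ < s := fun s hs ↦ ht₀.trans_le hs
  -- the key monotonicity step on an interval `[t₀, c]` where `y > 0` on `[t₀, c)`
  have step : ∀ c, t₀ ≤ c → (∀ s, t₀ ≤ s → s < c → 0 < y s) → y t₀ ≤ y c := by
    intro c hc hpos
    -- `y ≥ 0` on `[t₀, c]` by continuity, so `y'` is nondecreasing there
    have hnn : ∀ s ∈ Icc t₀ c, 0 ≤ y s := by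
      intro s hs
      rcases eq_or_lt_of_le hs.2 with hsc | hsc
      · -- `s = c`: limit of positive values
        subst hsc
        rcases eq_or_lt_of_le hs.1 with h0 | h0
        · rw [← h0]; exact hy0.le
        · have hcont : ContinuousWithinAt y (Iio s) s :=
            (h.hasDerivAt s (hcr s hs.1)).continuousAt.continuousWithinAt
          refine ge_of_tendsto (hcont.tendsto.mono_left (nhdsWithin_mono _ fun x hx ↦ hx)) ?_
          filter_upwards [Ioo_mem_nhdsLT h0] with x hx using (hpos x hx.1.le hx.2).le
      · exact (hpos s hs.1 hsc).le
    have hy'_mono : MonotoneOn y' (Icc t₀ c) := by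
      refine monotoneOn_of_deriv_nonneg (convex_Icc t₀ c)
        (fun s hs ↦ (h.hasDerivAt_deriv s (hcr s hs.1)).continuousAt.continuousWithinAt)
        (fun s hs ↦ (h.hasDerivAt_deriv s (hcr s (interior_subset hs).1)).differentiableAt.differentiableWithinAt)
        fun s hs ↦ ?_
      rw [interior_Icc] at hs
      rw [(h.hasDerivAt_deriv s (hcr s hs.1.le)).deriv]
      exact mul_nonneg (hQ s hs.1.le) (hnn s ⟨hs.1.le, hs.2.le⟩)
    have hy_mono : MonotoneOn y (Icc t₀ c) := by
      refine monotoneOn_of_deriv_nonneg (convex_Icc t₀ c)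
        (fun s hs ↦ (h.hasDerivAt s (hcr s hs.1)).continuousAt.continuousWithinAt)
        (fun s hs ↦ (h.hasDerivAt s (hcr s (interior_subset hs).1)).differentiableAt.differentiableWithinAt)
        fun s hs ↦ ?_
      rw [interior_Icc] at hs
      rw [h.deriv_eq (hcr s hs.1.le)]
      exact hy1.trans (hy'_mono ⟨le_rfl, hc⟩ ⟨hs.1.le, hs.2.le⟩ hs.1.le)
    exact hy_mono ⟨le_rfl, hc⟩ ⟨hc, le_rfl⟩ hc
  -- now argue by contradiction with the first non-positive value
  intro t ht
  by_contra hyt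
  push Not at hyt
  set Z : Set ℝ := Icc t₀ t ∩ y ⁻¹' Iic 0 with hZ
  have hZc : IsClosed Z :=
    (h.continuousOn.1.mono fun s hs ↦ hcr s hs.1).preimage_isClosed_of_isClosed isClosed_Icc isClosed_Iic
  have htZ : t ∈ Z := ⟨⟨ht, le_rfl⟩, hyt⟩
  have hZne : Z.Nonempty := ⟨t, htZ⟩
  have hZbdd : BddBelow Z := ⟨t₀, fun s hs ↦ hs.1.1⟩
  set c := sInf Z with hc
  have hcZ : c ∈ Z := hZc.csInf_mem hZne hZbdd
  have hc0 : t₀ ≤ c := hcZ.1.1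
  have hyc : y c ≤ 0 := hcZ.2
  have hpos : ∀ s, t₀ ≤ s → s < c → 0 < y s := by
    intro s hs hsc
    by_contra hneg
    push Not at hneg
    have hsZ : s ∈ Z := ⟨⟨hs, hsc.le.trans hcZ.1.2⟩, hneg⟩
    exact absurd (csInf_le hZbdd hsZ) (not_le.2 hsc)
  have := step c hc0 hpos
  linarith

/-- Under the hypotheses of `pos_of_nonneg`, `y` and `y'` are nondecreasing on `[t₀, ∞)`:
`y t₀ ≤ y t` and `y' t₀ ≤ y' t` for `t ≥ t₀`. [cite: Hartman2002, Ch. XI Cor. 6.4] -/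
theorem le_of_nonneg (h : IsSol2 Q y y' (Ioi r₀)) {t₀ : ℝ} (ht₀ : r₀ < t₀)
    (hQ : ∀ t, t₀ ≤ t → 0 ≤ Q t) (hy0 : 0 < y t₀) (hy1 : 0 ≤ y' t₀) {t : ℝ} (ht : t₀ ≤ t) :
    y t₀ ≤ y t ∧ y' t₀ ≤ y' t := by
  have hcr : ∀ s, t₀ ≤ s → r₀ < s := fun s hs ↦ ht₀.trans_le hs
  have hpos := h.pos_of_nonneg ht₀ hQ hy0 hy1
  have hy'_mono : MonotoneOn y' (Ici t₀) := by
    refine monotoneOn_of_deriv_nonneg (convex_Ici t₀)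
      (fun s hs ↦ (h.hasDerivAt_deriv s (hcr s hs)).continuousAt.continuousWithinAt)
      (fun s hs ↦ (h.hasDerivAt_deriv s (hcr s (interior_subset hs))).differentiableAt.differentiableWithinAt)
      fun s hs ↦ ?_
    rw [interior_Ici] at hs
    rw [(h.hasDerivAt_deriv s (hcr s hs.le)).deriv]
    exact mul_nonneg (hQ s hs.le) (hpos s hs.le).le
  have hy_mono : MonotoneOn y (Ici t₀) := by
    refine monotoneOn_of_deriv_nonneg (convex_Ici t₀)
      (fun s hs ↦ (h.hasDerivAt s (hcr s hs)).continuousAt.continuousWithinAt)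
      (fun s hs ↦ (h.hasDerivAt s (hcr s (interior_subset hs))).differentiableAt.differentiableWithinAt)
      fun s hs ↦ ?_
    rw [interior_Ici] at hs
    rw [h.deriv_eq (hcr s hs.le)]
    exact hy1.trans (hy'_mono Set.self_mem_Ici (Set.mem_Ici.2 hs.le) hs.le)
  exact ⟨hy_mono Set.self_mem_Ici ht ht, hy'_mono Set.self_mem_Ici ht ht⟩

/-! ## Sturm comparison with `sin` -/

/-- **Sturm's comparison theorem, oscillation form.** If `Q ≤ −k²` on `[A, A + π/k]` (`k > 0`,
`A > r₀`) then every solution of `y'' = Q y` on `(r₀, ∞)` has a zero in `[A, A + π/k]`: for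
`z = sin(k(t − A))` and a solution `y > 0` on the interval, the Wronskian `W = y z' − y' z` has
`W' = −(k² + Q) y z ≥ 0`, yet `W(A) = k y(A) > 0 > −k y(A + π/k) = W(A + π/k)`.
[cite: Hartman2002, Ch. XI Thm. 3.1] -/
theorem exists_zero_of_le_neg_sq (h : IsSol2 Q y y' (Ioi r₀)) {A k : ℝ} (hA : r₀ < A) (hk : 0 < k)
    (hQ : ∀ t ∈ Icc A (A + π / k), Q t ≤ -k ^ 2) : ∃ t ∈ Icc A (A + π / k), y t = 0 := by
  set B : ℝ := A + π / k with hB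
  have hAB : A < B := by
    rw [hB]; have := Real.pi_pos; have : 0 < π / k := by positivity
    linarith
  have hcr : ∀ s ∈ Icc A B, r₀ < s := fun s hs ↦ hA.trans_le hs.1
  by_contra hno
  push Not at hno
  -- reduce to a positive solution
  suffices key : ∀ (w w' : ℝ → ℝ), IsSol2 Q w w' (Ioi r₀) → (∀ t ∈ Icc A B, 0 < w t) → False by
    have hyc : ContinuousOn y (Icc A B) := h.continuousOn.1.mono fun s hs ↦ hcr s hs
    -- `y` has constant sign on `[A, B]`
    rcases lt_or_gt_of_ne (hno A ⟨le_rfl, hAB.le⟩) with hneg | hpos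
    · refine key (fun t ↦ -y t) (fun t ↦ -y' t) h.neg fun t ht ↦ ?_
      rcases lt_or_gt_of_ne (hno t ht) with h1 | h1
      · linarith
      · exfalso
        obtain ⟨c, hc, hyc0⟩ := intermediate_value_Icc ht.1 (hyc.mono (Icc_subset_Icc_right ht.2))
          ⟨hneg.le, h1.le⟩
        exact hno c ⟨hc.1, hc.2.trans ht.2⟩ hyc0
    · refine key y y' h fun t ht ↦ ?_
      rcases lt_or_gt_of_ne (hno t ht) with h1 | h1
      · exfalso
        obtain ⟨c, hc, hyc0⟩ := intermediate_value_Icc' ht.1 (hyc.mono (Icc_subset_Icc_right ht.2))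
          ⟨h1.le, hpos.le⟩
        exact hno c ⟨hc.1, hc.2.trans ht.2⟩ hyc0
      · exact h1
  intro w w' hw hwpos
  -- the comparison function and the Wronskian
  set z : ℝ → ℝ := fun t ↦ Real.sin (k * (t - A)) with hz
  set z' : ℝ → ℝ := fun t ↦ k * Real.cos (k * (t - A)) with hz'
  have hzd : ∀ t, HasDerivAt z (z' t) t := fun t ↦ by
    have := (((hasDerivAt_id t).sub_const A).const_mul k).sin
    simpa [hz, hz', mul_comm] using this
  have hz'd : ∀ t, HasDerivAt z' (-k ^ 2 * z t) t := fun t ↦ by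
    have := ((((hasDerivAt_id t).sub_const A).const_mul k).cos).const_mul k
    refine this.congr_deriv ?_
    simp [hz]; ring
  set W : ℝ → ℝ := fun t ↦ w t * z' t - w' t * z t with hW
  have hWd : ∀ t ∈ Icc A B, HasDerivAt W (-(k ^ 2 + Q t) * (w t * z t)) t := by
    intro t ht
    have h1 := ((hw.hasDerivAt t (hcr t ht)).mul (hz'd t)).sub ((hw.hasDerivAt_deriv t (hcr t ht)).mul (hzd t))
    refine h1.congr_deriv ?_
    ring
  -- `z ≥ 0` on `[A, B]`
  have hz_nonneg : ∀ t ∈ Icc A B, 0 ≤ z t := fun t ht ↦ by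
    apply Real.sin_nonneg_of_nonneg_of_le_pi
    · exact mul_nonneg hk.le (sub_nonneg.2 ht.1)
    · have : t - A ≤ π / k := by rw [hB] at ht; linarith [ht.2]
      calc k * (t - A) ≤ k * (π / k) := by gcongr
        _ = π := by field_simp
  -- `W` is nondecreasing on `[A, B]`
  have hWmono : MonotoneOn W (Icc A B) := by
    refine monotoneOn_of_deriv_nonneg (convex_Icc A B)
      (fun t ht ↦ (hWd t ht).continuousAt.continuousWithinAt)
      (fun t ht ↦ (hWd t (interior_subset ht)).differentiableAt.differentiableWithinAt) fun t ht ↦ ?_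
    have ht' : t ∈ Icc A B := interior_subset ht
    rw [(hWd t ht').deriv]
    have h1 : -(k ^ 2 + Q t) ≥ 0 := by linarith [hQ t ht']
    exact mul_nonneg h1 (mul_nonneg (hwpos t ht').le (hz_nonneg t ht'))
  have hWAB := hWmono ⟨le_rfl, hAB.le⟩ ⟨hAB.le, le_rfl⟩ hAB.le
  -- but `W A = k w(A) > 0` and `W B = −k w(B) < 0`
  have hWA : W A = k * w A := by simp [hW, hz, hz']; ring
  have hWB : W B = -k * w B := by
    have hkB : k * (B - A) = π := by rw [hB]; field_simp; ring
    simp [hW, hz, hz', hkB]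
    ring
  rw [hWA, hWB] at hWAB
  have h1 := hwpos A ⟨le_rfl, hAB.le⟩
  have h2 := hwpos B ⟨hAB.le, le_rfl⟩
  nlinarith

end IsSol2

end Literature.Analysis.ODE
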